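/-
Copyright (c) 2026 the pub-hodgecm-mathlib formalisation cell (harness21).  Prover seat hodgecm-mathlib-K2E4-p10 (g7), Track B ∕ K2-LIT, h413 = `stmt-HodgeConjecture-24833`,
line `K2_E1_TraceFormulaBeta`, 5Res ROADCARD «ENDGAME BY FAMILIES» §3′ M2 v2 (K2E1-plan (g7), D4′c → D5′ hand-over): the GLOBAL model map of a family's Plancherel isometry
(orthogonal projection onto the closed span followed by the isometry) — the `U : H →L M` binder of ★ D5′ `K2E1IrreducibleNoContinuousSpectrumU`.  Mathlib-only.
-/
import Summits.HodgeConjecture.HodgeConjecture.Theorems.K2E1PlancherelIsometryOfForm    -- ★ P3a p859954: `mem_topologicalClosure_span`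
import Mathlib.Analysis.InnerProductSpace.Projection.Basic
import HarnessLib

/-!
# D4′c → D5′ — `K2E1PlancherelModelMapOfIsometry`: the global model map `U = U_iso ∘ P_Θ : H →L[ℂ] M` of an isometry `U_iso` given on a closed span `Θ = closure span {x_i}`

Track B ∕ K2-LIT, crux h413 = `stmt-HodgeConjecture-24833`, route of record `HCCMUnconditional`; cell `hodgecm-mathlib`, squad K2, ENGINE E1.  THEOREMS ONLY (no `def`, no `instance`,
no `notation`, no named-fact hypothesis, no `sorry`; default heartbeats); lane `--supports stmt-HodgeConjecture-24833 --as helper` (count-neutral).  Mathlib-only (+ ★ P3a's membership lemma).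
THE MATHEMATICS ([ReedSimonI1980, Thm. II.3 (projection theorem), Thm. I.7]; [MoeglinWaldspurger1995, II.2.4]).  ★ D4′c delivers, per family block, a linear ISOMETRY `U_iso : Θ →ₗᵢ[ℂ] M`
on the closed span `Θ = closure span {x_i} ≤ H = L²(X, μ)` (OD: `M = L²(ℝ × K_U)`, ★ `exists_linearIsometry_chiSection_offDual_cm_two`; SD: `M = (⊕_{c∈S} V) ⊕₂ L²((0,∞); V)`, ★
`exists_linearIsometry_chiSection_selfDual_cm_two`).  ★ D5′ (`indicator_lpSMul_proj_eq_zero_of_irreducible_subrep`) and the E1 skeleton (β) take a GLOBAL linear `U : H →ₗ M`.  The canonical one is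
`U := U_iso ∘ P_Θ` with `P_Θ` the orthogonal projection onto `Θ` (`H` complete ⇒ `Θ` complete ⇒ `HasOrthogonalProjection`): `U = U_iso` on `Θ`, `U = 0` on `Θᗮ`, `‖U v‖ ≤ ‖v‖`, `U x_i = U_iso x_i`
(= the model vector of `x_i` by ★ D4′c), `⟪U v, U w⟫ = ⟪P_Θ v, P_Θ w⟫`, `range U = range U_iso` — all spelled on the EXPLICIT composite `U_iso.toContinuousLinearMap ∘L Θ.orthogonalProjectionOnto` (no `def`).
* §1 `completeSpace_topologicalClosure_span` (instance supply), `modelMap_apply_of_mem`, `modelMap_apply_eq_zero_of_mem_orthogonal`, `norm_modelMap_le`, **`modelMap_apply_generator`**, `inner_modelMap_modelMap`,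
  `modelMap_apply_eq_modelMap_proj`, **`range_modelMap`**.
HONEST LABEL: HC_CM is proved only modulo the 7 printed citations (2 remaining named inputs: hLiu418 = `stmt-HodgeConjecture-24832`, h413 = `stmt-HodgeConjecture-24833`) until rung 0
closes; this file asserts no named fact, closes no socket; count-neutral; letter-free.

## References
* [ReedSimonI1980] M. Reed, B. Simon, *Methods of Modern Mathematical Physics I* (1980), Thm. II.3, Thm. I.7.
* [MoeglinWaldspurger1995] C. Mœglin, J.-L. Waldspurger, *Spectral decomposition and Eisenstein series* (1995), II.2.4.
-/

set_option autoImplicit false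
set_option linter.dupNamespace false  -- the mandated namespace repeats the summit's segment (`HodgeConjecture.HodgeConjecture`)

noncomputable section

open scoped InnerProductSpace ComplexConjugate
open Summit.HodgeConjecture.HodgeConjecture.Cruxes.H413.K2E1PlancherelIsometryOfForm (mem_topologicalClosure_span)

namespace Summit.HodgeConjecture.HodgeConjecture.Cruxes.H413.K2E1PlancherelModelMapOfIsometry

variable {H M : Type*} [NormedAddCommGroup H] [InnerProductSpace ℂ H] [CompleteSpace H] [NormedAddCommGroup M] [InnerProductSpace ℂ M] {ι : Type*}

/-- The closed span `Θ = closure span {x_i}` of a family in a complete space is complete (so `Θ.HasOrthogonalProjection`). [cite: ReedSimonI1980, Thm. II.3] -/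
theorem completeSpace_topologicalClosure_span (x : ι → H) : CompleteSpace ↥(Submodule.span ℂ (Set.range x)).topologicalClosure :=
  (Submodule.isClosed_topologicalClosure _).completeSpace_coe

/-- **`U = U_iso` ON THE CLOSED SPAN**: `(U_iso ∘ P_Θ) v = U_iso v` for `v ∈ Θ`. [cite: ReedSimonI1980, Thm. II.3] -/
theorem modelMap_apply_of_mem (x : ι → H) (Uiso : ↥(Submodule.span ℂ (Set.range x)).topologicalClosure →ₗᵢ[ℂ] M)
    (v : ↥(Submodule.span ℂ (Set.range x)).topologicalClosure) :
    haveI := completeSpace_topologicalClosure_span x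
    (Uiso.toContinuousLinearMap.comp (Submodule.span ℂ (Set.range x)).topologicalClosure.orthogonalProjectionOnto) (v : H) = Uiso v := by
  haveI := completeSpace_topologicalClosure_span x
  rw [ContinuousLinearMap.comp_apply, Submodule.orthogonalProjectionOnto_mem_subspace_eq_self]
  rfl

/-- **`U = 0` ON `Θᗮ`**. [cite: ReedSimonI1980, Thm. II.3] -/
theorem modelMap_apply_eq_zero_of_mem_orthogonal (x : ι → H) (Uiso : ↥(Submodule.span ℂ (Set.range x)).topologicalClosure →ₗᵢ[ℂ] M)
    {v : H} (hv : v ∈ ((Submodule.span ℂ (Set.range x)).topologicalClosure)ᗮ) :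
    haveI := completeSpace_topologicalClosure_span x
    (Uiso.toContinuousLinearMap.comp (Submodule.span ℂ (Set.range x)).topologicalClosure.orthogonalProjectionOnto) v = 0 := by
  haveI := completeSpace_topologicalClosure_span x
  rw [ContinuousLinearMap.comp_apply, Submodule.orthogonalProjectionOnto_eq_zero_iff.2 hv]
  exact map_zero _

/-- **`‖U v‖ ≤ ‖v‖`** (`U_iso` isometric, `‖P_Θ‖ ≤ 1`). [cite: ReedSimonI1980, Thm. II.3] -/
theorem norm_modelMap_le (x : ι → H) (Uiso : ↥(Submodule.span ℂ (Set.range x)).topologicalClosure →ₗᵢ[ℂ] M) (v : H) :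
    haveI := completeSpace_topologicalClosure_span x
    ‖(Uiso.toContinuousLinearMap.comp (Submodule.span ℂ (Set.range x)).topologicalClosure.orthogonalProjectionOnto) v‖ ≤ ‖v‖ := by
  haveI := completeSpace_topologicalClosure_span x
  rw [ContinuousLinearMap.comp_apply, LinearIsometry.coe_toContinuousLinearMap, LinearIsometry.norm_map]
  exact Submodule.norm_orthogonalProjectionOnto_apply_le _ v

/-- **`U x_i = U_iso x_i`** — the model vector of the generator (by ★ D4′c: `√(C∕2π) • u_i` (OD) ∕ `(r_i, √κ • w_i)` (SD)). [cite: MoeglinWaldspurger1995, II.2.4] -/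
theorem modelMap_apply_generator (x : ι → H) (Uiso : ↥(Submodule.span ℂ (Set.range x)).topologicalClosure →ₗᵢ[ℂ] M) (i : ι) :
    haveI := completeSpace_topologicalClosure_span x
    (Uiso.toContinuousLinearMap.comp (Submodule.span ℂ (Set.range x)).topologicalClosure.orthogonalProjectionOnto) (x i) = Uiso ⟨x i, mem_topologicalClosure_span x i⟩ :=
  modelMap_apply_of_mem x Uiso ⟨x i, mem_topologicalClosure_span x i⟩

/-- **`⟪U v, U w⟫ = ⟪P_Θ v, P_Θ w⟫`** (`U_iso` preserves inner products). [cite: ReedSimonI1980, Thm. I.7] -/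
theorem inner_modelMap_modelMap (x : ι → H) (Uiso : ↥(Submodule.span ℂ (Set.range x)).topologicalClosure →ₗᵢ[ℂ] M) (v w : H) :
    haveI := completeSpace_topologicalClosure_span x
    ⟪(Uiso.toContinuousLinearMap.comp (Submodule.span ℂ (Set.range x)).topologicalClosure.orthogonalProjectionOnto) v,
      (Uiso.toContinuousLinearMap.comp (Submodule.span ℂ (Set.range x)).topologicalClosure.orthogonalProjectionOnto) w⟫_ℂ =
      ⟪((Submodule.span ℂ (Set.range x)).topologicalClosure.orthogonalProjectionOnto v : H), ((Submodule.span ℂ (Set.range x)).topologicalClosure.orthogonalProjectionOnto w : H)⟫_ℂ := by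
  haveI := completeSpace_topologicalClosure_span x
  rw [ContinuousLinearMap.comp_apply, ContinuousLinearMap.comp_apply, LinearIsometry.coe_toContinuousLinearMap, LinearIsometry.inner_map_map, Submodule.coe_inner]

/-- `U v = U (P_Θ v)` (the map factors through the projection). [folklore] -/
theorem modelMap_apply_eq_modelMap_proj (x : ι → H) (Uiso : ↥(Submodule.span ℂ (Set.range x)).topologicalClosure →ₗᵢ[ℂ] M) (v : H) :
    haveI := completeSpace_topologicalClosure_span x
    (Uiso.toContinuousLinearMap.comp (Submodule.span ℂ (Set.range x)).topologicalClosure.orthogonalProjectionOnto) v =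
      (Uiso.toContinuousLinearMap.comp (Submodule.span ℂ (Set.range x)).topologicalClosure.orthogonalProjectionOnto)
        ((Submodule.span ℂ (Set.range x)).topologicalClosure.orthogonalProjectionOnto v : H) := by
  haveI := completeSpace_topologicalClosure_span x
  rw [modelMap_apply_of_mem]
  rfl

/-- **`range U = range U_iso`** (`P_Θ` is onto `Θ`); with ★ P3a `range_linearIsometry_eq_topologicalClosure_span` this is the closed span of the model vectors. [cite: ReedSimonI1980, Thm. I.7] -/
theorem range_modelMap (x : ι → H) (Uiso : ↥(Submodule.span ℂ (Set.range x)).topologicalClosure →ₗᵢ[ℂ] M) :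
    haveI := completeSpace_topologicalClosure_span x
    Set.range (Uiso.toContinuousLinearMap.comp (Submodule.span ℂ (Set.range x)).topologicalClosure.orthogonalProjectionOnto) = Set.range Uiso := by
  haveI := completeSpace_topologicalClosure_span x
  apply Set.Subset.antisymm
  · rintro _ ⟨v, rfl⟩
    exact ⟨_, rfl⟩
  · rintro _ ⟨v, rfl⟩
    exact ⟨(v : H), modelMap_apply_of_mem x Uiso v⟩

end Summit.HodgeConjecture.HodgeConjecture.Cruxes.H413.K2E1PlancherelModelMapOfIsometry

end
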